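import Mathlib
import HarnessLib
import Summits.HubbardSuperconductivity.HubbardSuperconductivity.Theorems.ChiralWindowCwKLChiralWindowCertTrig
import Literature.MathematicalPhysics.QuantumLattice.KohnLuttingerFermiCurvePolarIntegral
import Literature.MathematicalPhysics.QuantumLattice.HubbardFermiRadiusBandContinuous

/-!
# Route `WeakCouplingBCS` — support item `WcbcsKohnLuttingerB1g` (stmt-HubbardSuperconductivity-0158):
# polar transport of the certificate's block quantities (first rungs R1, R1′ of the in-kernel discharge of `EnclosuresB1g`)

The named numerical hypothesis `KLCert.EnclosuresB1g` of the item (`Theorems/WeakCouplingBCSDefs.lean`) is a list of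
inequalities between rationals and integrals of the record's trial functions `KLBlock.trialFun tab = (klTab tab i).toFun`
against the Fermi-curve measure `σ_μ = fermiCurveMeasure (squareDispersion 1 0) μ` (Ritz norms `∫ Φ² dσ_μ`, Rayleigh numerators,
far-channel Hilbert–Schmidt masses).  The tree already writes `σ_μ` in polar coordinates
(`Literature…KohnLuttingerFermiCurvePolarIntegral.integral_fermiCurveMeasure`: `∫ f dσ_μ = ∫_{(-π,π]} w_μ(θ) f(γ_μ(θ)) dθ`,
`γ_μ = fermiPolar μ`, `w_μ = fermiPolarDOS μ`).  This helper file supplies the two bookkeeping identities an in-kernel verified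
quadrature needs (cell gate-hubbard-kl, HOME/eng/ENCLOSURES-SCOPE.md (c) R1/R1′), both for every `-4 < μ < 0`:

* `klpt_toFun_fermiPolar` — **on the polar curve the tabulated trial functions ARE their angular formulas**:
  `(KLTrig.toFun t) (fermiPolar μ θ) = t.eval θ = Σ a_j cos(jθ) + Σ b_j sin(jθ)` (the angle `arg γ_μ(θ) ≡ θ (mod 2π)` and
  integer frequencies); hence **R1** `klpt_integral_trialFun_sq` : `∫ Φ² dσ_μ = ∫_{θ ∈ (-π,π]} w_μ(θ) · (t.eval θ)² dθ`, and the
  general form `klpt_integral_comp_trialFun` for `∫ F(Φ(k)) dσ_μ(k)`;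
* **R1′** `klpt_fermiPolarDOS_eq` — **the quadrature-friendly density of states**: `w_μ(θ) = u_μ(θ) / ∂_tF(θ, u_μ(θ))` with
  `u_μ = bandFermiRadius μ` the Fermi radius and `∂_tF = rayDispersionDt θ t = 2(cos θ sin(t cos θ) + sin θ sin(t sin θ))` — no
  derivative of the radius and no gradient norm (from `‖γ'‖² = u'² + u²`, `u' = -∂_θF/∂_tF`, `‖∇ε(γ)‖² = (∂_tF)² + (∂_θF/u)²`).

Everything is proved; no definitions; no named facts. [folklore]
-/

noncomputable section

-- the tree's namespace `Summit.<Summit>.<Problem>.Theorems` repeats the summit name by design (D-0017)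
set_option linter.dupNamespace false

namespace Summit.HubbardSuperconductivity.HubbardSuperconductivity.Theorems

open MeasureTheory Set Real CwKLChiralWindow Literature.MathematicalPhysics.QuantumLattice

/-! ### The trial functions on the polar curve -/

/-- The angular formula is `2π`-periodic (integer frequencies). [folklore] -/
theorem klpt_eval_add_int_mul_two_pi (t : KLTrig) (θ : ℝ) (m : ℤ) :
    t.eval (θ + m * (2 * π)) = t.eval θ := by
  unfold KLTrig.eval
  have hc : ∀ p : ℕ × ℚ, Real.cos ((p.1 : ℝ) * (θ + m * (2 * π))) = Real.cos ((p.1 : ℝ) * θ) := by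
    intro p
    have : (p.1 : ℝ) * (θ + m * (2 * π)) = (p.1 : ℝ) * θ + ((p.1 : ℤ) * m : ℤ) * (2 * π) := by push_cast; ring
    rw [this, Real.cos_add_int_mul_two_pi]
  have hs : ∀ p : ℕ × ℚ, Real.sin ((p.1 : ℝ) * (θ + m * (2 * π))) = Real.sin ((p.1 : ℝ) * θ) := by
    intro p
    have : (p.1 : ℝ) * (θ + m * (2 * π)) = (p.1 : ℝ) * θ + ((p.1 : ℤ) * m : ℤ) * (2 * π) := by push_cast; ring
    rw [this, Real.sin_add_int_mul_two_pi]
  simp_rw [hc, hs]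

/-- The angular formula only depends on the angle modulo `2π`. [folklore] -/
theorem klpt_eval_congr_angle (t : KLTrig) {θ₁ θ₂ : ℝ} (h : (θ₁ : Real.Angle) = θ₂) : t.eval θ₁ = t.eval θ₂ := by
  rw [Real.Angle.angle_eq_iff_two_pi_dvd_sub] at h
  obtain ⟨m, hm⟩ := h
  have : θ₁ = θ₂ + m * (2 * π) := by linarith
  rw [this, klpt_eval_add_int_mul_two_pi]

/-- **On the polar curve the tabulated trial function is its angular formula**: `t.toFun (γ_μ θ) = t.eval θ`
(`γ_μ θ ≠ 0` and `arg γ_μ θ ≡ θ (mod 2π)`). [folklore] -/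
theorem klpt_toFun_fermiPolar {μ : ℝ} (hμ₁ : -4 < μ) (hμ₂ : μ < 0) (t : KLTrig) (θ : ℝ) :
    t.toFun (fermiPolar μ θ) = t.eval θ := by
  classical
  unfold KLTrig.toFun
  rw [if_neg (fermiPolar_ne_zero hμ₁ hμ₂ θ)]
  exact klpt_eval_congr_angle t (arg_fermiPolar_coe_angle hμ₁ hμ₂ θ)

/-- The block trial function on the polar curve: `(b.trialFun tab) (γ_μ θ) = (klTab tab b.trial).eval θ`. [folklore] -/
theorem klpt_trialFun_fermiPolar {μ : ℝ} (hμ₁ : -4 < μ) (hμ₂ : μ < 0) (b : KLBlock) (tab : List KLTrig) (θ : ℝ) :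
    b.trialFun tab (fermiPolar μ θ) = (klTab tab b.trial).eval θ :=
  klpt_toFun_fermiPolar hμ₁ hμ₂ _ θ

/-! ### R1 — the block integrals as `θ`-integrals -/

/-- **`∫ F(Φ(k)) dσ_μ(k) = ∫_{(-π,π]} w_μ(θ) F(t.eval θ) dθ`** for every tabulated trial function `Φ = t.toFun` and every
continuous `F` (Bochner; `integral_fermiCurveMeasure` + `klpt_toFun_fermiPolar`). [folklore] -/
theorem klpt_integral_comp_toFun {μ : ℝ} (hμ₁ : -4 < μ) (hμ₂ : μ < 0) (t : KLTrig) {F : ℝ → ℝ} (hF : Continuous F) :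
    ∫ k, F (t.toFun k) ∂fermiCurveMeasure (squareDispersion 1 0) μ =
      ∫ θ in Ioc (-π) π, fermiPolarDOS μ θ * F (t.eval θ) := by
  have hmeas : AEStronglyMeasurable (fun k => F (t.toFun k)) (fermiCurveMeasure (squareDispersion 1 0) μ) :=
    (hF.measurable.comp (kl_tr_measurable_toFun t)).aestronglyMeasurable
  rw [integral_fermiCurveMeasure hμ₁ hμ₂ hmeas]
  refine setIntegral_congr_fun measurableSet_Ioc fun θ _ => ?_
  simp only [klpt_toFun_fermiPolar hμ₁ hμ₂]

/-- **R1 — the Ritz norm of a block trial as a `θ`-integral**: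
`∫ Φ² dσ_μ = ∫_{θ ∈ (-π,π]} w_μ(θ) · ((klTab tab b.trial).eval θ)² dθ`. [folklore] -/
theorem klpt_integral_trialFun_sq {μ : ℝ} (hμ₁ : -4 < μ) (hμ₂ : μ < 0) (b : KLBlock) (tab : List KLTrig) :
    ∫ k, b.trialFun tab k ^ 2 ∂fermiCurveMeasure (squareDispersion 1 0) μ =
      ∫ θ in Ioc (-π) π, fermiPolarDOS μ θ * (klTab tab b.trial).eval θ ^ 2 :=
  klpt_integral_comp_toFun hμ₁ hμ₂ (klTab tab b.trial) (continuous_pow 2)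

/-- The record-level form of R1 (all windows at once): `EnclTransportNorm` of ENCLOSURES-SCOPE (c). [folklore] -/
theorem klpt_enclTransportNorm :
    ∀ μ ∈ Ioo (-4 : ℝ) 0, ∀ (tab : List KLTrig) (b : KLBlock),
      ∫ k, b.trialFun tab k ^ 2 ∂fermiCurveMeasure (squareDispersion 1 0) μ =
        ∫ θ in Ioc (-π) π, fermiPolarDOS μ θ * (klTab tab b.trial).eval θ ^ 2 :=
  fun _ hμ tab b => klpt_integral_trialFun_sq hμ.1 hμ.2 b tab

/-! ### R1′ — the density of states as radius over radial derivative -/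

/-- The algebra behind R1′: `(u'² + u²) · (∂_tF)² = u² · ‖∇ε(γ)‖²` with `u' = -∂_θF/∂_tF`, `‖∇ε(γ)‖² = 4(sin²γ₀ + sin²γ₁)`.
[folklore] -/
theorem klpt_speed_sq_mul_Dt_sq {μ : ℝ} (hμ₁ : -4 < μ) (hμ₂ : μ < 0) (θ : ℝ) :
    (bandFermiRadiusDeriv μ θ ^ 2 + bandFermiRadius μ θ ^ 2) * rayDispersionDt θ (bandFermiRadius μ θ) ^ 2 =
      bandFermiRadius μ θ ^ 2 *
        (4 * (Real.sin (fermiPolar μ θ 0) ^ 2 + Real.sin (fermiPolar μ θ 1) ^ 2)) := by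
  have hDt := (rayDispersionDt_bandFermiRadius_pos hμ₁ hμ₂ θ).ne'
  rw [fermiPolar_apply_zero, fermiPolar_apply_one, bandFermiRadiusDeriv, div_pow,
    div_add' _ _ _ (pow_ne_zero 2 hDt), div_mul_cancel₀ _ (pow_ne_zero 2 hDt)]
  set u := bandFermiRadius μ θ
  rw [rayDispersionDθ, rayDispersionDt]
  have hcs := Real.cos_sq_add_sin_sq θ
  linear_combination (4 * u ^ 2 * (Real.sin (u * Real.cos θ) ^ 2 + Real.sin (u * Real.sin θ) ^ 2)) * hcs

/-- **R1′ — `w_μ(θ) = u_μ(θ) / ∂_tF(θ, u_μ(θ))`**: the polar density of states of the Fermi-curve measure is the Fermi radius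
divided by the radial derivative `∂_tF(θ,t) = 2(cos θ sin(t cos θ) + sin θ sin(t sin θ))` of the ray dispersion
`F(θ,t) = -2(cos(t cos θ) + cos(t sin θ))` (the form a verified quadrature wants; `FermiPolarDOSRay` of ENCLOSURES-SCOPE (c)).
[folklore] -/
theorem klpt_fermiPolarDOS_eq {μ : ℝ} (hμ₁ : -4 < μ) (hμ₂ : μ < 0) (θ : ℝ) :
    fermiPolarDOS μ θ = bandFermiRadius μ θ / rayDispersionDt θ (bandFermiRadius μ θ) := by
  have hDt := rayDispersionDt_bandFermiRadius_pos hμ₁ hμ₂ θ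
  have hu := bandFermiRadius_pos hμ₁ hμ₂ θ
  have hS := sin_sq_add_sin_sq_fermiPolar_pos hμ₁ hμ₂ θ
  have hsqrt : 0 < 2 * Real.sqrt (Real.sin (fermiPolar μ θ 0) ^ 2 + Real.sin (fermiPolar μ θ 1) ^ 2) :=
    mul_pos two_pos (Real.sqrt_pos.2 hS)
  rw [fermiPolarDOS, div_eq_div_iff hsqrt.ne' hDt.ne']
  -- both sides are non-negative: compare squares
  have hnorm : ‖fermiPolarVelocity μ θ‖ = Real.sqrt (bandFermiRadiusDeriv μ θ ^ 2 + bandFermiRadius μ θ ^ 2) := by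
    rw [← norm_fermiPolarVelocity_sq, Real.sqrt_sq (norm_nonneg _)]
  rw [hnorm, ← Real.sqrt_sq hDt.le, ← Real.sqrt_mul (by positivity), klpt_speed_sq_mul_Dt_sq hμ₁ hμ₂,
    Real.sqrt_mul (sq_nonneg _), Real.sqrt_sq hu.le, Real.sqrt_mul (by norm_num : (0:ℝ) ≤ 4),
    show Real.sqrt 4 = 2 by rw [show (4:ℝ) = 2 ^ 2 by norm_num, Real.sqrt_sq (by norm_num : (0:ℝ) ≤ 2)]]

/-- The record-level form of R1′ (all windows at once): `FermiPolarDOSRay` of ENCLOSURES-SCOPE (c). [folklore] -/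
theorem klpt_fermiPolarDOSRay :
    ∀ μ ∈ Ioo (-4 : ℝ) 0, ∀ θ : ℝ,
      fermiPolarDOS μ θ = bandFermiRadius μ θ / rayDispersionDt θ (bandFermiRadius μ θ) :=
  fun _ hμ θ => klpt_fermiPolarDOS_eq hμ.1 hμ.2 θ

/-- **R1 + R1′ combined — the Ritz norm in quadrature form**:
`∫ Φ² dσ_μ = ∫_{(-π,π]} (u_μ(θ)/∂_tF(θ,u_μ(θ))) · (Σ a_j cos jθ + Σ b_j sin jθ)² dθ`. [folklore] -/
theorem klpt_integral_trialFun_sq_ray {μ : ℝ} (hμ₁ : -4 < μ) (hμ₂ : μ < 0) (b : KLBlock) (tab : List KLTrig) :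
    ∫ k, b.trialFun tab k ^ 2 ∂fermiCurveMeasure (squareDispersion 1 0) μ =
      ∫ θ in Ioc (-π) π,
        bandFermiRadius μ θ / rayDispersionDt θ (bandFermiRadius μ θ) * (klTab tab b.trial).eval θ ^ 2 := by
  rw [klpt_integral_trialFun_sq hμ₁ hμ₂]
  refine setIntegral_congr_fun measurableSet_Ioc fun θ _ => ?_
  simp only [klpt_fermiPolarDOS_eq hμ₁ hμ₂]

end Summit.HubbardSuperconductivity.HubbardSuperconductivity.Theorems

end
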